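import Mathlib
import HarnessLib.Audit.Tags
import Summits.Ventures.ResidMod.Conjectures.PairSumCertificate
import Summits.Ventures.ResidMod.Conjectures.ResultantCertificate
import Summits.Ventures.ResidMod.Conjectures.ResultantNormalisation
import Summits.Ventures.ResidMod.Conjectures.NormCertificate
import Summits.Ventures.ResidMod.Conjectures.IntegerCertificate

/-!
# The divisibility form of the pair-sum certificate implies `HasTwoBlocks` (TODO-29 (b2′), composite; bus R311/R315)

Honest framing: a two-line composition of PROVED results; elementary Galois theory of rational sextics; no curve, no
Galois-image determination, no modularity claim, no new census, nothing numerical, no instrument touched.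
`ResultantCertificate.lean` proves: `F ∣ Res_Y(S(Y), F(Y − x))` (Sylvester sizes `3, 6`) ⇒ every root `r` of `F`
has a root `y` of `S` with `F(y − r) = 0` over the splitting field of `F·S`
(`pairSum_splittingField_of_dvd_resultant`); `PairSumCertificate.lean` proves: that root form, for
`F = toRatPoly f` irreducible and `S` an irreducible cubic, ⇒ `HasTwoBlocks f` (`hasTwoBlocks_of_pairSum`).  This
file records the composite exactly as registered on the cell bus before any proof (R311 items (5), (6), cell
«pub-residmod», 2026-08-23) and the bookkeeping with `M23_twoBlocks_card_dvd` (`ImprimitiveCertificates.lean`):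
`|Gal| ∣ 144 ∧ ¬ Typical`; the sharp `∣ 48` is the further composite with `M23_twoBlocks_card_dvd_48`
(`TwoBlocksSharp.lean`), not restated here.  What is NOT typed (b2″, bus R314): the identity
`R_inst(x) = ± lc¹⁸ · Res_Y(S(Y), F(Y − x))` relating the instrument's norm `R_inst` to the Sylvester resultant.

`ResultantNormalisation.lean` proves that the instrument's normalisation (`S̃ = lc³·S(Y/lc)` as
`(S.map C).scaleRoots (C lc)`, `G = lc⁶·F(Y/lc − x)` as `C (C lc) · (F(Y − x)).integralNormalization`) gives the same
divisibility (`dvd_resultant_instrumentNormalisation_iff`), whence `hasTwoBlocks_of_dvd_resultant_inst`; after it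
only (b2″-b) «the instrument's 3×3 norm determinant = the 9×9 Sylvester resultant for monic `S̃`» is untyped.

`NormCertificate.lean` proves that the instrument's NORM form `F ∣ Algebra.norm ℚ[X] (AdjoinRoot.mk S̃ G)` (the
determinant of multiplication by `G` on `ℚ[x][Y]/(S̃)`, which is what `res23.py` computes) gives the root form
directly (`pairSum_splittingField_of_dvd_norm`), whence `hasTwoBlocks_of_dvd_norm`; after it only the
coefficient embedding `ℤ[x] ⊂ ℚ[x]` and «`S̃` irreducible ⇔ `S` irreducible» are untyped.

`IntegerCertificate.lean` reads the instrument's INTEGER data in `ℚ[x]` (norm base change `ℤ[x] → ℚ[x]`,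
rational root theorem for the monic integer cubic, irreducibility under root scaling), whence the END-TO-END composite
`hasTwoBlocks_of_integerCertificate`: its hypotheses are the instrument's integer certificate verbatim — the
integer sextic `f`, a monic integer cubic `S̃` with no integer root, and `f ∣ Norm_{ℤ[x][Y]/(S̃)}(G)` in `ℤ[x]`; and
(v2, bus R328 after referee g43 R-7/R-8) the HARDENED-CONTRACT composite `hasTwoBlocks_of_integerCertificateQ`: a
witness `p : ℕ` with `S̃` rootless modulo `p` replaces the float-seeded integer-root search, and the divisibility is
read in `ℚ[x]` (`pdivisible`'s literal contract: `toRatPoly f ∣ (Norm_ℤ …).map ι`).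

Main results (PROVED, axioms `propext`, `Classical.choice`, `Quot.sound` only):
* `hasTwoBlocks_of_dvd_resultant` — divisibility form ⇒ `HasTwoBlocks`;
* `hasTwoBlocks_of_dvd_resultant_inst` — the same from the instrument's normalisation of the resultant;
* `hasTwoBlocks_of_dvd_norm` — the same from the instrument's NORM form;
* `hasTwoBlocks_of_ratCertificate`, `hasTwoBlocks_of_integerCertificate`, `hasTwoBlocks_of_integerCertificateQ`,
  `M23_not_typical_of_integerCertificate` — the instrument's INTEGER certificate (ℤ[x]-divisibility, resp. the
  hardened contract: witness prime + ℚ[x]-divisibility) ⇒ `HasTwoBlocks f` ⇒ `Nat.card (toRatPoly f).Gal ∣ 144 ∧ ¬ Typical f`;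
* `M23_not_typical_of_dvd_resultant` — divisibility form ⇒ `Nat.card (toRatPoly f).Gal ∣ 144 ∧ ¬ Typical f`.
-/

open Polynomial

namespace Summit.Ventures.ResidMod.Conjectures

/-- **(5) The divisibility form of the pair-sum certificate gives two-element blocks.**  For an integer sextic `f`
with `f 6 ≠ 0`, irreducible over `ℚ`, and an irreducible cubic `S ∈ ℚ[X]` with
`toRatPoly f ∣ Res_Y(S(Y), F(Y − x))` (`F = toRatPoly f`, Sylvester sizes `3, 6`): `HasTwoBlocks f`.
[elementary Galois theory] -/
theorem hasTwoBlocks_of_dvd_resultant (f : Sextic) (hf : f 6 ≠ 0) (hirr : Irreducible (toRatPoly f)) (S : ℚ[X])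
    (hS3 : S.natDegree = 3) (hSirr : Irreducible S)
    (hdvd : toRatPoly f ∣ resultant (S.map (C : ℚ →+* ℚ[X]))
      (((toRatPoly f).map (C : ℚ →+* ℚ[X])).comp (X - C (X : ℚ[X]))) 3 6) :
    HasTwoBlocks f :=
  hasTwoBlocks_of_pairSum f hf hirr S hS3 hSirr
    (pairSum_splittingField_of_dvd_resultant (natDegree_toRatPoly hf) hS3 hdvd)

/-- **(5′) The instrument's normalisation form gives two-element blocks.**  As (5), with the hypothesis
`toRatPoly f ∣ Res_Y(S̃, G)` in the instrument's normalisation (`ResultantNormalisation.lean`). [bookkeeping] -/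
theorem hasTwoBlocks_of_dvd_resultant_inst (f : Sextic) (hf : f 6 ≠ 0) (hirr : Irreducible (toRatPoly f))
    (S : ℚ[X]) (hS3 : S.natDegree = 3) (hSirr : Irreducible S)
    (hdvd : toRatPoly f ∣ resultant (((S.map (C : ℚ →+* ℚ[X])).scaleRoots (C (toRatPoly f).leadingCoeff)))
      (C (C (toRatPoly f).leadingCoeff) *
        (((toRatPoly f).map (C : ℚ →+* ℚ[X])).comp (X - C (X : ℚ[X]))).integralNormalization) 3 6) :
    HasTwoBlocks f :=
  hasTwoBlocks_of_dvd_resultant f hf hirr S hS3 hSirr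
    ((dvd_resultant_instrumentNormalisation_iff _ S (natDegree_toRatPoly hf) hS3).mp hdvd)

/-- **(5″) The instrument's NORM form gives two-element blocks.**  For an integer sextic `f` with `f 6 ≠ 0`,
irreducible over `ℚ`, a monic irreducible cubic `S ∈ ℚ[X]`, and
`toRatPoly f ∣ Norm_{ℚ[x][Y]/(S̃)}(G)` (`S̃ = (S.map C).scaleRoots (C lc)`,
`G = C (C lc)·(F(Y − x)).integralNormalization`, `lc = (toRatPoly f).leadingCoeff`): `HasTwoBlocks f`
(`NormCertificate.lean` + `hasTwoBlocks_of_pairSum`).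
[bookkeeping] -/
theorem hasTwoBlocks_of_dvd_norm (f : Sextic) (hf : f 6 ≠ 0) (hirr : Irreducible (toRatPoly f))
    (S : ℚ[X]) (hS3 : S.natDegree = 3) (hSm : S.Monic) (hSirr : Irreducible S)
    (hdvd : toRatPoly f ∣ Algebra.norm ℚ[X] (AdjoinRoot.mk
      ((S.map (C : ℚ →+* ℚ[X])).scaleRoots (C (toRatPoly f).leadingCoeff))
      (C (C (toRatPoly f).leadingCoeff) *
        (((toRatPoly f).map (C : ℚ →+* ℚ[X])).comp (X - C (X : ℚ[X]))).integralNormalization))) :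
    HasTwoBlocks f :=
  hasTwoBlocks_of_pairSum f hf hirr S hS3 hSirr
    (pairSum_splittingField_of_dvd_norm (natDegree_toRatPoly hf) hSm hdvd)

/-- **(A5) The norm form with the SCALED cubic.**  (9′) restated with the instrument's scaled monic cubic
`St = lc³·S(Y/lc)` (roots `lc·sᵢ`) in place of `(S.map C).scaleRoots (C lc)`: the pair-sum cubic is recovered as
`S := St.scaleRoots lc⁻¹`. [bookkeeping] -/
theorem pairSum_splittingField_of_dvd_norm_scaled {F St : ℚ[X]} (hF6 : F.natDegree = 6) (hStm : St.Monic)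
    (hdvd : F ∣ Algebra.norm ℚ[X] (AdjoinRoot.mk (St.map (C : ℚ →+* ℚ[X]))
      (C (C F.leadingCoeff) * ((F.map (C : ℚ →+* ℚ[X])).comp (X - C (X : ℚ[X]))).integralNormalization))) :
    ∀ r ∈ F.rootSet (F * St.scaleRoots F.leadingCoeff⁻¹).SplittingField,
      ∃ y ∈ (St.scaleRoots F.leadingCoeff⁻¹).rootSet (F * St.scaleRoots F.leadingCoeff⁻¹).SplittingField,
        y - r ∈ F.rootSet (F * St.scaleRoots F.leadingCoeff⁻¹).SplittingField := by
  have hF0 : F ≠ 0 := by rintro rfl; simp at hF6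
  have hlc0 : F.leadingCoeff ≠ 0 := leadingCoeff_ne_zero.mpr hF0
  have hSm : (St.scaleRoots F.leadingCoeff⁻¹).Monic := (monic_scaleRoots_iff _).mpr hStm
  have hkey : ((St.scaleRoots F.leadingCoeff⁻¹).map (C : ℚ →+* ℚ[X])).scaleRoots (C F.leadingCoeff)
      = St.map (C : ℚ →+* ℚ[X]) := by
    rw [← Polynomial.map_scaleRoots _ _ (C : ℚ →+* ℚ[X]) (by rw [hSm.leadingCoeff, map_one]; exact one_ne_zero),
      ← scaleRoots_mul, inv_mul_cancel₀ hlc0, scaleRoots_one]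
  exact pairSum_splittingField_of_dvd_norm hF6 hSm (by rw [hkey]; exact hdvd)

/-- **(5°) The rational reading of an integer certificate gives `HasTwoBlocks`.**  Common tail of (5‴)/(5⁗): an
irreducible integer sextic `f`, a monic integer cubic `Sz = S̃` IRREDUCIBLE over `ℚ`, and the RATIONAL norm
divisibility for the mapped data (conclusion of `dvd_norm_map_of_dvd_norm_int` / `dvd_norm_map_of_map_dvd_map_norm_int`,
`IntegerCertificate.lean`) give `HasTwoBlocks f` with the pair-sum cubic `S = (Sz.map ι).scaleRoots lc⁻¹`.
[bookkeeping over `IntegerCertificate.lean`, `NormCertificate.lean`, `PairSumCertificate.lean`] -/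
theorem hasTwoBlocks_of_ratCertificate (f : Sextic) (hf : f 6 ≠ 0) (hirr : Irreducible (toRatPoly f))
    (Sz : ℤ[X]) (hSz3 : Sz.natDegree = 3) (hSzm : Sz.Monic) (hSirr : Irreducible (Sz.map (Int.castRingHom ℚ)))
    (h : (toPoly f).map (Int.castRingHom ℚ) ∣ Algebra.norm ℚ[X] (AdjoinRoot.mk
      ((Sz.map (Int.castRingHom ℚ)).map (C : ℚ →+* ℚ[X]))
      (C (C ((toPoly f).map (Int.castRingHom ℚ)).leadingCoeff) *
        ((((toPoly f).map (Int.castRingHom ℚ)).map (C : ℚ →+* ℚ[X])).comp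
          (X - C (X : ℚ[X]))).integralNormalization))) :
    HasTwoBlocks f := by
  have hF6 := natDegree_toRatPoly hf
  have hF0 : toRatPoly f ≠ 0 := by intro h; rw [h, natDegree_zero] at hF6; exact absurd hF6 (by norm_num)
  have hlc0 : (toRatPoly f).leadingCoeff ≠ 0 := leadingCoeff_ne_zero.mpr hF0
  have hStm : (Sz.map (Int.castRingHom ℚ)).Monic := hSzm.map _
  have hSt3 : (Sz.map (Int.castRingHom ℚ)).natDegree = 3 := by rw [hSzm.natDegree_map, hSz3]
  exact hasTwoBlocks_of_pairSum f hf hirr ((Sz.map (Int.castRingHom ℚ)).scaleRoots (toRatPoly f).leadingCoeff⁻¹)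
    (by rw [natDegree_scaleRoots, hSt3]) (irreducible_scaleRoots_of_ne_zero hSirr (inv_ne_zero hlc0))
    (pairSum_splittingField_of_dvd_norm_scaled hF6 hStm h)

/-- **(5‴) END-TO-END: the instrument's INTEGER certificate gives `HasTwoBlocks`.**  Hypotheses = the rung-23a IRRED
certificate with ℤ[x]-divisibility: the integer sextic `f` (`f 6 ≠ 0`, irreducible over `ℚ`), a monic integer cubic
`Sz = S̃` with NO INTEGER ROOT, and the integer divisibility `toPoly f ∣ Norm_{ℤ[x][Y]/(S̃)}(G)`,
`G = C (C lc)·(f(Y − x)).integralNormalization` (`= lc⁶·f(Y/lc − x)` coefficientwise), `Algebra.norm` = determinant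
of multiplication (the instrument's `norm_cubic` in the basis `1, Y, Y²`).  Conclusion: `HasTwoBlocks f`.
[bookkeeping over `IntegerCertificate.lean`, `NormCertificate.lean`, `PairSumCertificate.lean`] -/
theorem hasTwoBlocks_of_integerCertificate (f : Sextic) (hf : f 6 ≠ 0) (hirr : Irreducible (toRatPoly f))
    (Sz : ℤ[X]) (hSz3 : Sz.natDegree = 3) (hSzm : Sz.Monic) (hno : ∀ n : ℤ, ¬ Sz.IsRoot n)
    (hdvd : toPoly f ∣ Algebra.norm ℤ[X] (AdjoinRoot.mk (Sz.map (C : ℤ →+* ℤ[X]))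
      (C (C (toPoly f).leadingCoeff) *
        (((toPoly f).map (C : ℤ →+* ℤ[X])).comp (X - C (X : ℤ[X]))).integralNormalization))) :
    HasTwoBlocks f := by
  have hF0 : toRatPoly f ≠ 0 := by
    intro h; have h6 := natDegree_toRatPoly hf; rw [h, natDegree_zero] at h6; exact absurd h6 (by norm_num)
  have hfz : toPoly f ≠ 0 := by
    intro h; apply hF0; change (toPoly f).map (Int.castRingHom ℚ) = 0; rw [h, Polynomial.map_zero]
  exact hasTwoBlocks_of_ratCertificate f hf hirr Sz hSz3 hSzm (irreducible_map_of_forall_not_isRoot hSzm hSz3 hno)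
    (dvd_norm_map_of_dvd_norm_int hfz hSzm hdvd)

/-- **(5⁗) END-TO-END, HARDENED CONTRACT (bus R328, referee g43 R-7/R-8): the instrument's certificate READ
LITERALLY gives `HasTwoBlocks`.**  Hypotheses = the per-member output of the hardened instrument verbatim: the
integer sextic `f` (`f 6 ≠ 0`, irreducible over `ℚ`), a monic integer cubic `Sz = S̃`, a WITNESS `p : ℕ` with
`S̃` rootless modulo `p` (a finite check; `p = 0` is the integer-root test), and `pdivisible`'s contract — the
divisibility of the INTEGER norm by `f` IN `ℚ[x]`, `toRatPoly f ∣ (Norm_{ℤ[x][Y]/(S̃)}(G)).map ι`.  Every hypothesis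
except `Irreducible (toRatPoly f)` is a finite or exact computation. [bookkeeping over `IntegerCertificate.lean`,
`NormCertificate.lean`, `PairSumCertificate.lean`] -/
theorem hasTwoBlocks_of_integerCertificateQ (f : Sextic) (hf : f 6 ≠ 0) (hirr : Irreducible (toRatPoly f))
    (Sz : ℤ[X]) (hSz3 : Sz.natDegree = 3) (hSzm : Sz.Monic) (p : ℕ)
    (hno : ∀ y : ZMod p, ¬ (Sz.map (Int.castRingHom (ZMod p))).IsRoot y)
    (hdvd : toRatPoly f ∣ (Algebra.norm ℤ[X] (AdjoinRoot.mk (Sz.map (C : ℤ →+* ℤ[X]))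
      (C (C (toPoly f).leadingCoeff) *
        (((toPoly f).map (C : ℤ →+* ℤ[X])).comp (X - C (X : ℤ[X]))).integralNormalization))).map
          (Int.castRingHom ℚ)) :
    HasTwoBlocks f := by
  have hF0 : toRatPoly f ≠ 0 := by
    intro h; have h6 := natDegree_toRatPoly hf; rw [h, natDegree_zero] at h6; exact absurd h6 (by norm_num)
  have hfz : toPoly f ≠ 0 := by
    intro h; apply hF0; change (toPoly f).map (Int.castRingHom ℚ) = 0; rw [h, Polynomial.map_zero]
  exact hasTwoBlocks_of_ratCertificate f hf hirr Sz hSz3 hSzm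
    (irreducible_map_of_forall_not_isRoot_zmod hSzm hSz3 p hno) (dvd_norm_map_of_map_dvd_map_norm_int hfz hSzm hdvd)

/-- **(6′) Bookkeeping.**  The instrument's INTEGER certificate for a non-degenerate irreducible sextic gives
`Nat.card (toRatPoly f).Gal ∣ 144` and `¬ Typical f` (with `TwoBlocksSharp.lean`: `∣ 48`). [bookkeeping] -/
theorem M23_not_typical_of_integerCertificate (f : Sextic) (hnd : NonDegenerate f)
    (hirr : Irreducible (toRatPoly f)) (Sz : ℤ[X]) (hSz3 : Sz.natDegree = 3) (hSzm : Sz.Monic)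
    (hno : ∀ n : ℤ, ¬ Sz.IsRoot n)
    (hdvd : toPoly f ∣ Algebra.norm ℤ[X] (AdjoinRoot.mk (Sz.map (C : ℤ →+* ℤ[X]))
      (C (C (toPoly f).leadingCoeff) *
        (((toPoly f).map (C : ℤ →+* ℤ[X])).comp (X - C (X : ℤ[X]))).integralNormalization))) :
    Nat.card (toRatPoly f).Gal ∣ 144 ∧ ¬ Typical f := by
  have h144 := M23_twoBlocks_card_dvd f hnd (hasTwoBlocks_of_integerCertificate f hnd.1 hirr Sz hSz3 hSzm hno hdvd)
  refine ⟨h144, fun htyp => ?_⟩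
  unfold Typical at htyp
  have := Nat.le_of_dvd (by norm_num) h144
  omega

/-- **(6) Bookkeeping.**  Under the hypotheses of `hasTwoBlocks_of_dvd_resultant` and `NonDegenerate f`:
`Nat.card (toRatPoly f).Gal ∣ 144` and `f` is not `Typical` (via `M23_twoBlocks_card_dvd`). [bookkeeping] -/
theorem M23_not_typical_of_dvd_resultant (f : Sextic) (hnd : NonDegenerate f) (hirr : Irreducible (toRatPoly f))
    (S : ℚ[X]) (hS3 : S.natDegree = 3) (hSirr : Irreducible S)
    (hdvd : toRatPoly f ∣ resultant (S.map (C : ℚ →+* ℚ[X]))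
      (((toRatPoly f).map (C : ℚ →+* ℚ[X])).comp (X - C (X : ℚ[X]))) 3 6) :
    Nat.card (toRatPoly f).Gal ∣ 144 ∧ ¬ Typical f := by
  have h144 := M23_twoBlocks_card_dvd f hnd (hasTwoBlocks_of_dvd_resultant f hnd.1 hirr S hS3 hSirr hdvd)
  refine ⟨h144, fun htyp => ?_⟩
  unfold Typical at htyp
  have := Nat.le_of_dvd (by norm_num) h144
  omega

end Summit.Ventures.ResidMod.Conjectures
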